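import Literature.AlgebraicGeometry.Markman2025.SecantQuotientCarrier
import Literature.AlgebraicGeometry.Motives.AbelianVarietyProductDimProofs
import Literature.AlgebraicGeometry.HodgeTheory.SecantQuotientAnchorTwistedCarrier
import Summits.HodgeConjecture.HodgeConjecture.Theorems.VHCAbelianSchemesRoadServedFibre
import Summits.HodgeConjecture.HodgeConjecture.Theorems.VHCAbelianSchemesRoadDegreeConfinement
import HarnessLib

/-!
# Road b02 (`VHCAbelianSchemesRoad`, D-0059) — GEOMETRIC SECANT–QUOTIENT ANCHORS for the `(6,3)` rung of crux
# `SemiregularSheafRepresentativesTwAtDiag` (item stmt-HodgeConjecture-19787): the anchor predicate, the served classes,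
# the `(6,3)` ANCHORED-CARRIER statement (a′) and the `(6,3)` RESIDUAL (b′) of skeleton v3 (definitions + fact-free glue)

research route conditional on HC_CM; not a corollary; Q11.4-sentence-2 already refuted in dim ≥ 3.

DEFINITIONS AND FACT-FREE GLUE ONLY (`HC_CM` nowhere; no cell, carrier, residual, K-SR♭∃, VHC, `HC_AV` or HC asserted). The
served-fibre partition of a cell (`VHCAbelianSchemesRoadServedFibreDefs`: `HasServedFibre`, `AnchoredCarrierAt`,
`LefAtExceptionalRegimeAtUnder`) is ANCHOR-GENERIC; its first intended instance is Markman's secant anchor (arXiv:2502.03415,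
PREPRINT). The output-level instance `VHCAbelianSchemesRoadSecantAnchorDefs` (anchors := «`θ` at which `X` CARRIES a pinned
datum») makes the anchored-carrier statement a fact-free theorem and the residual kernel-equivalent to the rung (ring2 ruling
L151.4; J note cda2c912 §1) — a partition cut by the outcome. THIS file types the anchor GEOMETRICALLY, with NO output clause,
over the carriers of `Literature/AlgebraicGeometry/Markman2025/SecantQuotientCarrier` (p503739):

* `SecantQuotientDatum` — Markman's INPUT data (§1.5, §9.3): a smooth projective complex curve `C`, a Jacobian `𝒥` of `C`
  with `dim J = 3`, a Riemann theta divisor `Θ` of `𝒥` that is a principal polarization divisor, an EVEN level `d ≥ 4`,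
  cyclic subgroups `G₁, G₂ ≤ J[d+1](ℂ)` of order `d+1` with `G₁ ⊓ G₂ = ⊥`, and the TYPABLE genericity of Lemma 9.3.1:
  the translates `τ_s(Θ)`, `s ∈ G₁ + G₂`, in general position (`Markman2025.TranslatesInGeneralPosition`). From it, BY
  F4's constructions (no choices): `D.P = J × Ĵ`, `D.ψ = φ_d` (`Markman2025.weilOperator`, `φ_d ≫ φ_d = −d` a THEOREM),
  `D.Y = (J × Ĵ)/Ḡ` (`Markman2025.secantQuotient`), `D.q : J × Ĵ → Y` the quotient isogeny (`secantQuotientMap`, `q^*`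
  bijective on complex cohomology).
* `IsSecantQuotientWeilClassAt X θ γ` — `(X, θ)` is a CHART of a secant quotient `Y` (`e : X ≅ D.Y.X`) polarised by a class
  `θ` which is a polarisation class on `X` (`IsPolarizationClass 6 X θ`), lies on the line of an AMPLE divisor of `Y`, and
  makes `(J × Ĵ, φ_d)` of HYPERBOLIC Weil type for `q^*θ` (`Motives.IsHyperbolicWeilType`, van Geemen's `det H = (−1)³`;
  Markman Lemma 3.1.3), and `γ ∈ H⁶(X)` is a RATIONAL class OFF the ray `ℂ·θ³` whose pull-back `q^*γ` is a WEIL class of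
  `(J × Ĵ, φ_d)` (`weilClassesOf _ _ 3 d`). `secantQuotientServedClasses X θ := {γ | …}`, `secantQuotientAnchors X θ :=
  ∃ γ, …` — the anchor data `(𝔄, 𝔖)` of the partition, the SAME for every Chern character theory `C`.
* `SecantQuotientAnchorCarrier63 C` (a′) `:= AnchoredCarrierAt (tw C AdmTw) 6 3 𝔄 𝔖` and `SecantQuotientResidual63 C` (b′)
  `:= LefAtExceptionalRegimeAtUnder (tw C AdmTw) 6 3 (¬ HasServedFibre 6 3 𝔄 𝔖)`, `tw C AdmTw :=
  twistedReflexiveClass C (gluableSigmaAdmissible ∨ bfSingleAdmissible)` the crux's twisted door VERBATIM; both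
  `@[conjecture]`, OPEN, HYPOTHESES wherever used.
* §4 fact-free glue BY NAME over `VHCAbelianSchemesRoadServedFibre` (route-independent: this module imports NO `Theses` file):
  (a′) ∧ (b′) ⟹ the registered `(6,3)` rung `∀ C, LefAtExceptionalRegimeSixfoldMiddle (tw C AdmTw)`; the rung ⟹ (b′). The crux BY
  NAME from the `(4,2)` cell, (a′), (b′) and the tail `m ≥ 4` is composed in the skeleton (`Cruxes/…/Lines/birth.lean` v3) by
  `twAtDiag_of_firstCell_of_anchoredCarrierAt_of_residual_of_tail` (`VHCAbelianSchemesRoadServedFibreItems`).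

HONEST GAPS between (a′) and print (carried as (a′)'s «why it might fail»; nothing hidden): (G1) Markman's `C` is a GENERIC
NON-HYPERELLIPTIC genus-3 curve (Thm. 1.4.1; §9.2 Assumption 9.2.1, Prop. 9.2.2: the secant sheaf is reflexive of rank `8d`
under genericity) — «non-hyperelliptic ∕ generic» is not typable on current carriers (carriers NAME-TABLE LIMIT 4), so the
datum ranges over an ENVELOPE of print's anchors, narrowed only by Lemma 9.3.1's general position; (G2) print polarises `Y_d`
by the descent `h` of the `Spin(V)_P`-invariant ample class `Ξ_P(x, y) = (f x, y)_V` (§2.4, p. 15; rank-one invariant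
Néron–Severi, Prop. 2.4.4 ∕ p. 45) — here `θ` is ANY ample-line polarisation class with `(J × Ĵ, φ_d)` hyperbolic for `q^*θ`
(equal to `h` up to `ℚˣ` when the `φ_d`-compatible Néron–Severi line is one-dimensional, wider otherwise); (G3) print SERVES ONE
direction per anchor — the Weil component `w₀ = (q^*)⁻¹`-image of `κ₃(𝓔̄)` (§1.5, Lemma 9.3.11; Thm. 1.4.1 item 4 spans
`ℚh³ ⊕ ĤW` by `η(K)`-translates at CLASS level only) — whereas `𝔖` here is EVERY rational class of `ℂθ³ ⊕ (Weil plane)` off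
the ray. So (a′) is citation-expected from a PREPRINT at print's anchors in print's direction and OPEN beyond (G1)–(G3); (b′)
is honest either way, implied by the rung fact-free (§4) and NOT known to imply it (that needs (a′)).

What is NOT claimed: (a′), (b′), any cell, the rung, the crux, K-SR♭∃, VHC, `HC_AV`, HC; that the datum type is inhabited
(existence of genus-3 curves with Jacobians and level structures is standard but not typed here); that Markman's object-level
claim-tagged fact `HodgeTheory.Markman2025_secantQuotientAnchor_twistedCarrier_sixfold` (p497016, under review) implies (a′) (it gives
ONE anchor per `d` with ONE served class — (G1)–(G3)). References: [cite: Markman2025SecantWeil, §1.5, Thm. 1.4.1, §2.4,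
Lemma 3.1.3, §9.2 Prop. 9.2.2, §9.3 Lemma 9.3.1, Lemma 9.3.3, Remark 9.3.7, Lemma 9.3.11] [cite: Bloch1972Semiregularity, Remark (7.5)]
[cite: BuchweitzFlenner2003, §5 Thm. 5.1] [cite: vanGeemen1994HodgeAV, Lemma 5.2, 5.4 and Thm. 4.11] [cite: MumfordAV1970, §7 Thm. 4 p. 72].
-/

noncomputable section

open CategoryTheory CategoryTheory.Limits AlgebraicGeometry Topology

namespace Summit.HodgeConjecture.HodgeConjecture.Ring2.SemiregularRepresentatives

set_option linter.dupNamespace false -- the cell's namespace repeats the summit name, as in every `Ring2*` file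

open Literature.AlgebraicGeometry Literature.AlgebraicGeometry.Motives Literature.AlgebraicGeometry.Motives.AbelianVariety
open Literature.AlgebraicGeometry.HodgeTheory Literature.AlgebraicGeometry.Markman2025
open Literature.AlgebraicTopology.SingularHomology
open Literature.Barriers.HodgeConjecture (divisorClassesSpan)
open Summit.Ventures.HSemireg (ObjClass)

/-! ## §1 Markman's input data and the objects F4 builds from it -/

/-- **A SECANT–QUOTIENT DATUM** — the INPUT of Markman's construction at level `d` (§1.5, §9.3): a smooth projective complex
curve `C`, a Jacobian `𝒥` of `C` of dimension `3` (genus `3`), a Riemann theta divisor `Θ` of `𝒥` which is a principal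
polarization divisor, an even level `d ≥ 4` (§1.5 footnote, Lemma 9.3.5, Remark 9.3.7: `d` even for the untwisted descent),
cyclic subgroups `G₁, G₂ ≤ J[d+1](ℂ)` of order `d+1` meeting trivially (Lemma 9.3.3), and Lemma 9.3.1's general position of
the `(d+1)²` translates `τ_{g₁+g₂}(Θ)`. «Generic non-hyperelliptic `C`» (Thm. 1.4.1) is NOT a field: gap (G1) of the module
docstring. [cite: Markman2025SecantWeil, §1.5 (p. 7), Thm. 1.4.1, §9.3 Lemma 9.3.1 and Lemma 9.3.3] -/
structure SecantQuotientDatum where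
  /-- the level `d` (`K = ℚ(√−d)`). -/
  d : ℕ
  /-- the curve `C`. -/
  C : SchemeOver ℂ
  /-- `C` is a smooth projective curve. -/
  smooth : IsSmoothProjective 1 C
  /-- a Jacobian of `C`. -/
  𝒥 : Jacobian C
  /-- genus `3`: `dim J(C) = 3`. -/
  dim_J : 𝒥.J.dim = 3
  /-- the theta divisor. -/
  Θ : CartierDivisor 𝒥.J.X.left
  /-- `Θ` is a Riemann theta divisor of `𝒥` (a translate of `W_{g−1}`). -/
  riemann : 𝒥.IsRiemannThetaDivisor Θ
  /-- `Θ` is a principal polarization divisor (`Θ` ample, `K(Θ) = 0`). -/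
  principal : 𝒥.J.IsPrincipalPolarizationDivisor Θ
  /-- the first cyclic subgroup `G₁ ≤ J[d+1](ℂ)`. -/
  G₁ : Subgroup (𝒥.J.Points ℂ)
  /-- the second cyclic subgroup `G₂ ≤ J[d+1](ℂ)`. -/
  G₂ : Subgroup (𝒥.J.Points ℂ)
  /-- `G₁ ≤ J[d+1](ℂ)`. -/
  G₁_le : G₁ ≤ 𝒥.J.torsionPoints ℂ (d + 1 : ℕ)
  /-- `G₂ ≤ J[d+1](ℂ)`. -/
  G₂_le : G₂ ≤ 𝒥.J.torsionPoints ℂ (d + 1 : ℕ)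
  /-- `d` is even. -/
  even : Even d
  /-- `d ≥ 4`. -/
  four_le : 4 ≤ d
  /-- `G₁` is cyclic. -/
  cyclic₁ : IsCyclic G₁
  /-- `#G₁ = d + 1`. -/
  card₁ : Nat.card G₁ = d + 1
  /-- `G₂` is cyclic. -/
  cyclic₂ : IsCyclic G₂
  /-- `#G₂ = d + 1`. -/
  card₂ : Nat.card G₂ = d + 1
  /-- `G₁ ∩ G₂ = 0`. -/
  disjoint : G₁ ⊓ G₂ = ⊥
  /-- Lemma 9.3.1's general position of the translates `τ_s(Θ)`, `s ∈ G₁ + G₂`. -/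
  generalPosition : TranslatesInGeneralPosition 𝒥.J Θ (sumSet G₁ G₂)

namespace SecantQuotientDatum

variable (D : SecantQuotientDatum)

/-- `Θ` is ample. [cite: Markman2025SecantWeil, §1.5 (p. 7)] -/
theorem isAmple : D.Θ.IsAmple := D.principal.isAmple

/-- `K(Θ) = 0`. [cite: Markman2025SecantWeil, §9.3 Lemma 9.3.3] -/
theorem KTheta_eq_bot : D.𝒥.J.KTheta D.Θ = ⊥ := D.principal.KTheta_eq_bot

/-- `d + 1 ≠ 0`. [folklore] -/
theorem succ_ne_zero : D.d + 1 ≠ 0 := Nat.succ_ne_zero D.d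

/-- **`P := J × Ĵ`**, Markman's `X × X̂` (`X = Pic²(C) ≅ J(C)`). [cite: Markman2025SecantWeil, §1.3 and §1.5 (p. 7)] -/
def P : AbelianVariety ℂ := D.𝒥.J.prod (D.𝒥.J.dualOf D.Θ D.isAmple)

/-- **`ψ := φ_d = η(√−d) : (x, y) ↦ (−d·φ_Θ⁻¹ y, φ_Θ x)`** on `J × Ĵ` (F4 `weilOperator`). [cite: Markman2025SecantWeil, §3.2] -/
def ψ : D.P ⟶ D.P := weilOperator D.isAmple D.KTheta_eq_bot D.d

/-- **`Y := (J × Ĵ)/Ḡ`**, Markman's secant quotient at level `d` (F4 `secantQuotient`). [cite: Markman2025SecantWeil, §1.5 (p. 7)] -/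
def Y : AbelianVariety ℂ := secantQuotient D.𝒥.J D.isAmple D.G₁ D.G₂ D.succ_ne_zero D.G₁_le D.G₂_le

/-- **`q : J × Ĵ → Y`**, the quotient isogeny (F4 `secantQuotientMap`). [cite: Markman2025SecantWeil, §1.5 (p. 7)] -/
def q : D.P ⟶ D.Y := secantQuotientMap D.𝒥.J D.isAmple D.G₁ D.G₂ D.succ_ne_zero D.G₁_le D.G₂_le

/-- `φ_d ≫ φ_d = −(d • 𝟙)` — a THEOREM of F4, not a clause of the datum. [cite: Markman2025SecantWeil, §3.2] -/
theorem ψ_comp_ψ : D.ψ ≫ D.ψ = -((D.d : ℤ) • 𝟙 D.P) := weilOperator_comp_self D.isAmple D.KTheta_eq_bot D.d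

/-- `q` is an isogeny. [cite: MumfordAV1970, §7 Thm. 4 p. 72] -/
theorem isIsogeny_q : IsIsogeny D.q := isIsogeny_secantQuotientMap D.𝒥.J D.isAmple D.G₁ D.G₂ D.succ_ne_zero D.G₁_le D.G₂_le

/-- `q^*` is bijective on complex cohomology in every degree. [cite: vanGeemen1994HodgeAV, §3.6 (p. 236)] -/
theorem complexBetti_map_q_bijective (k : ℕ) : Function.Bijective (complexBetti.map D.q.hom.hom.hom k) :=
  complexBetti_map_secantQuotientMap_bijective D.𝒥.J D.isAmple D.G₁ D.G₂ D.succ_ne_zero D.G₁_le D.G₂_le k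

/-- `dim (J × Ĵ) = 6`. [cite: Markman2025SecantWeil, §1.5 (p. 7)] -/
theorem dim_P : D.P.dim = 6 := by
  rw [P, dim_prod, dim_dualOf, D.dim_J]

/-- `dim Y = 6` (an abelian SIXFOLD). [cite: Markman2025SecantWeil, §1.5 (p. 7)] -/
theorem dim_Y : D.Y.dim = 6 := by
  rw [Y, dim_secantQuotient D.𝒥.J D.isAmple D.G₁ D.G₂ D.succ_ne_zero D.G₁_le D.G₂_le (dim_prod _ _), D.dim_J]

/-- `#Ḡ = (d+1)²`. [cite: Markman2025SecantWeil, §1.5 (p. 7) and §9.3 Lemma 9.3.3] -/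
theorem natCard_rouquierImage : Nat.card (rouquierImage D.𝒥.J D.isAmple D.G₁ D.G₂) = (D.d + 1) * (D.d + 1) := by
  rw [natCard_rouquierImage_of_inf_eq_bot D.isAmple D.KTheta_eq_bot D.disjoint, D.card₁, D.card₂]

/-- **`Y` lies in F4's envelope `IsSecantQuotientSixfold d`** (forgetting parity, `d ≥ 4` and general position).
[cite: Markman2025SecantWeil, §1.5 (p. 7) and §9.3 (p. 70)] -/
theorem isSecantQuotientSixfold : IsSecantQuotientSixfold D.d D.Y :=
  ⟨D.C, D.smooth, D.𝒥, D.dim_J, D.Θ, D.riemann, D.principal, D.G₁, D.G₂, D.G₁_le, D.G₂_le,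
    D.cyclic₁, D.card₁, D.cyclic₂, D.card₂, D.disjoint, ⟨Iso.refl _⟩⟩

end SecantQuotientDatum

/-! ## §2 The geometric anchor predicate and the served classes -/

/-- **`γ` is a SECANT–QUOTIENT WEIL CLASS on the polarised variety `(X, θ)` (`IsSecantQuotientWeilClassAt X θ γ`)**: there are
a secant–quotient datum `D` and a CHART `e : X ≅ D.Y.X` (so the predicate respects isomorphisms of `X` by construction) such
that `θ` is a polarisation class on `X` (`IsPolarizationClass 6 X θ`: rational, supported on a divisor, hard Lefschetz),
`θ` read on `Y` is the class of an AMPLE divisor up to a scalar (`IsPolarizationClassOf`), `(J × Ĵ, φ_d)` is of HYPERBOLIC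
Weil type for `q^*θ` (Markman Lemma 3.1.3: `det H = (−1)³`), and `γ` is a RATIONAL class, NOT on the ray `ℂ·θ³`, whose
pull-back `q^*γ` lies in the plane of Weil classes of `(J × Ĵ, φ_d)` in degree `6`. Print's anchor `(Y_d, h)` with its
served class satisfies this at a generic curve; the predicate is WIDER than print by (G1)–(G3) of the module docstring.
[cite: Markman2025SecantWeil, §1.5 (p. 7), Thm. 1.4.1, §2.4 and Lemma 3.1.3] [cite: vanGeemen1994HodgeAV, Lemma 5.2 and 5.4] -/
def IsSecantQuotientWeilClassAt (X : SchemeOver ℂ) (θ : complexBetti X 2) (γ : complexBetti X (2 * 3)) : Prop :=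
  ∃ (D : SecantQuotientDatum) (e : X ≅ D.Y.X),
    IsPolarizationClass 6 X θ ∧
    (∃ H : CartierDivisor D.Y.X.left, H.IsAmple ∧ D.Y.IsPolarizationClassOf H (complexBetti.map e.inv 2 θ)) ∧
    IsHyperbolicWeilType D.P D.ψ 3 (complexBetti.map D.q.hom.hom.hom 2 (complexBetti.map e.inv 2 θ)) ∧
    IsRationalClass γ ∧ γ ∉ (ℂ ∙ cupPowTwo θ 3) ∧
    complexBetti.map D.q.hom.hom.hom (2 * 3) (complexBetti.map e.inv (2 * 3) γ) ∈ weilClassesOf D.P D.ψ 3 D.d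

/-- **The SERVED classes at a secant–quotient anchor**: `𝔖 X θ := {γ | IsSecantQuotientWeilClassAt X θ γ}` — the rational
classes of `ℂθ³ ⊕ (Weil plane)` off the ray (gap (G3): print serves ONE such direction). [cite: Markman2025SecantWeil, Thm. 1.4.1 and §1.5] -/
def secantQuotientServedClasses (X : SchemeOver ℂ) (θ : complexBetti X 2) : Set (complexBetti X (2 * 3)) :=
  {γ | IsSecantQuotientWeilClassAt X θ γ}

/-- **`(X, θ)` is a SECANT–QUOTIENT ANCHOR**: some class is a secant–quotient Weil class on `(X, θ)` — `X` is a chart of a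
secant quotient `Y_d` (`d` even `≥ 4`) Weil-compatibly polarised by `θ`. NO output clause (nothing about data carried).
[cite: Markman2025SecantWeil, §1.5 (p. 7) and Thm. 1.4.1] -/
def secantQuotientAnchors (X : SchemeOver ℂ) (θ : complexBetti X 2) : Prop :=
  ∃ γ : complexBetti X (2 * 3), IsSecantQuotientWeilClassAt X θ γ

variable {X : SchemeOver ℂ} {θ : complexBetti X 2} {γ : complexBetti X (2 * 3)}

/-- Membership in the served set, unfolded (definitional). [cite: Markman2025SecantWeil, Thm. 1.4.1] -/
theorem mem_secantQuotientServedClasses_iff : γ ∈ secantQuotientServedClasses X θ ↔ IsSecantQuotientWeilClassAt X θ γ :=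
  Iff.rfl

/-- The anchor predicate, unfolded (definitional). [cite: Markman2025SecantWeil, §1.5 (p. 7)] -/
theorem secantQuotientAnchors_iff : secantQuotientAnchors X θ ↔ ∃ γ, γ ∈ secantQuotientServedClasses X θ := Iff.rfl

/-- A served class witnesses the anchor. [cite: Markman2025SecantWeil, §1.5 (p. 7)] -/
theorem secantQuotientAnchors_of_mem (h : γ ∈ secantQuotientServedClasses X θ) : secantQuotientAnchors X θ := ⟨γ, h⟩

namespace IsSecantQuotientWeilClassAt

/-- `θ` is a polarisation class on `X`. [cite: Markman2025SecantWeil, §2.4] -/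
theorem isPolarizationClass (h : IsSecantQuotientWeilClassAt X θ γ) : IsPolarizationClass 6 X θ := by
  obtain ⟨_, _, hθ, -⟩ := h
  exact hθ

/-- `γ` is rational. [cite: Markman2025SecantWeil, Thm. 1.4.1] -/
theorem isRationalClass (h : IsSecantQuotientWeilClassAt X θ γ) : IsRationalClass γ := by
  obtain ⟨_, _, -, -, -, hγ, -⟩ := h
  exact hγ

/-- `γ` is off the ray `ℂ·θ³`. [cite: Markman2025SecantWeil, Thm. 1.4.1 (item 4)] -/
theorem not_mem_span (h : IsSecantQuotientWeilClassAt X θ γ) : γ ∉ (ℂ ∙ cupPowTwo θ 3) := by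
  obtain ⟨_, _, -, -, -, -, hγ, -⟩ := h
  exact hγ

/-- **ENVELOPE**: the underlying variety is a secant-quotient sixfold of F4's envelope, of an even level `d ≥ 4`.
[cite: Markman2025SecantWeil, §1.5 (p. 7)] -/
theorem exists_isSecantQuotientSixfold (h : IsSecantQuotientWeilClassAt X θ γ) :
    ∃ (d : ℕ) (Y : AbelianVariety ℂ), Even d ∧ 4 ≤ d ∧ Y.dim = 6 ∧ IsSecantQuotientSixfold d Y ∧ Nonempty (X ≅ Y.X) := by
  obtain ⟨D, e, -⟩ := h
  exact ⟨D.d, D.Y, D.even, D.four_le, D.dim_Y, D.isSecantQuotientSixfold, ⟨e⟩⟩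

/-- **The Weil structure behind a served class**: abelian sixfolds `P`, `Y`, `ψ₀ ≫ ψ₀ = −d` on `P`, an isogeny `q : P → Y`
bijective on complex cohomology, a chart `X ≅ Y.X`, `(P, ψ₀)` hyperbolic for `q^*θ`, `q^*γ` a Weil class — the HYPOTHESIS
part of the object-level claim-tagged fact's shape `HasSecantCarrierWeilAnchor`, WITHOUT its datum clause.
[cite: Markman2025SecantWeil, §1.5 (p. 7) and Lemma 3.1.3] -/
theorem exists_weilStructure (h : IsSecantQuotientWeilClassAt X θ γ) :
    ∃ (d : ℕ) (P Y : AbelianVariety ℂ) (ψ₀ : P ⟶ P) (q : P ⟶ Y) (e : X ≅ Y.X),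
      Even d ∧ 4 ≤ d ∧ P.dim = 6 ∧ Y.dim = 6 ∧ ψ₀ ≫ ψ₀ = -((d : ℤ) • 𝟙 P) ∧ IsIsogeny q ∧
      (∀ k : ℕ, Function.Bijective (complexBetti.map q.hom.hom.hom k)) ∧
      IsHyperbolicWeilType P ψ₀ 3 (complexBetti.map q.hom.hom.hom 2 (complexBetti.map e.inv 2 θ)) ∧
      IsRationalClass γ ∧ γ ∉ (ℂ ∙ cupPowTwo θ 3) ∧
      complexBetti.map q.hom.hom.hom (2 * 3) (complexBetti.map e.inv (2 * 3) γ) ∈ weilClassesOf P ψ₀ 3 d := by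
  obtain ⟨D, e, -, -, hW, hγ, hray, hmem⟩ := h
  exact ⟨D.d, D.P, D.Y, D.ψ, D.q, e, D.even, D.four_le, D.dim_P, D.dim_Y, D.ψ_comp_ψ, D.isIsogeny_q,
    D.complexBetti_map_q_bijective, hW, hγ, hray, hmem⟩

end IsSecantQuotientWeilClassAt

/-! ## §3 The `(6,3)` anchored-carrier statement (a′) and residual (b′) for the crux's twisted door -/

/-- **(a′) THE SECANT–QUOTIENT ANCHORED-CARRIER STATEMENT at `(6,3)` for the crux's twisted door `tw C AdmTw`
(`SecantQuotientAnchorCarrier63 C`)**: at every secant–quotient anchor `(X, θ)` and every served rational class `γ`, an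
`AdmTw`-admissible `B`-twisted bounded complex of vector bundles ON `X` with `κ₃ = a·γ + c₃·θ³`, `a ≠ 0`, `κ_k = c_k·θᵏ`
(`k ∈ I ∖ {3}`) — `AnchoredCarrierAt` at `(𝔄, 𝔖) = (secantQuotientAnchors, secantQuotientServedClasses)`. CITATION-EXPECTED
at print's anchors in print's direction (arXiv:2502.03415 Thm. 1.4.1 + §1.5 + Lemma 9.3.11 + Remark 9.3.7, PREPRINT; the
object-level claim-tagged fact `Markman2025_secantQuotientAnchor_twistedCarrier_sixfold`); OPEN beyond, by the gaps (G1) genericity,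
(G2) polarisation class, (G3) served directions of the module docstring — WHY IT MIGHT FAIL: at special (e.g. hyperelliptic)
curves the secant sheaf may fail to be reflexive of rank `8d` (Prop. 9.2.2), and no carrier is in print for directions of the
Weil plane other than `κ₃(𝓔̄)`'s. A HYPOTHESIS wherever used. [cite: Markman2025SecantWeil, Thm. 1.4.1, §1.5, §9.2 Prop. 9.2.2 and Lemma 9.3.11]
[cite: Bloch1972Semiregularity, Remark (7.5)] -/
@[conjecture] def SecantQuotientAnchorCarrier63 (C : ChernCharacterBetti) : Prop :=
  AnchoredCarrierAt (Literature.AlgebraicGeometry.HodgeTheory.twistedReflexiveClass C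
      (fun n X₀ I E => Summit.Ventures.HSemireg.gluableSigmaAdmissible n X₀ I E ∨
        Literature.AlgebraicGeometry.HodgeTheory.bfSingleAdmissible n X₀ I E)) 6 3
    (fun X θ ↦ secantQuotientAnchors X θ) (fun X θ ↦ secantQuotientServedClasses X θ)

/-- **(b′) THE SECANT–QUOTIENT RESIDUAL at `(6,3)` for the crux's twisted door (`SecantQuotientResidual63 C`)**: the cell
`LefAtExceptionalRegimeAt (tw C AdmTw) 6 3` RESTRICTED to the one-parameter abelian sixfold pencils `(f, W)` with NO served
secant–quotient fibre (`¬ HasServedFibre 6 3 𝔄 𝔖 f W`: no fibre `𝒳_{sₐ}` which, with the restriction of a global fibrewise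
rational `(1,1)` class `Θ`, is a chart of a Weil-compatibly polarised secant quotient `Y_d` at which `W|_{sₐ}` is a served
class). Implied by the rung fact-free (§4); NOT known to imply it; contains the very general NON-SPLIT `(6,3)` Weil-type pencils
(`δ ≠ [−1]`: no split-secant fibre) — the regime where the class target is open in print. OPEN; a HYPOTHESIS wherever used;
skeleton v3's proposed T3 designate. [cite: vanGeemen1994HodgeAV, §2.4, Thm. 4.11 and 5.4] [cite: Markman2025SecantWeil, §1.5 and Thm. 1.5.1]
[cite: Bloch1972Semiregularity, Remark (7.5)] -/
@[conjecture] def SecantQuotientResidual63 (C : ChernCharacterBetti) : Prop :=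
  LefAtExceptionalRegimeAtUnder (Literature.AlgebraicGeometry.HodgeTheory.twistedReflexiveClass C
      (fun n X₀ I E => Summit.Ventures.HSemireg.gluableSigmaAdmissible n X₀ I E ∨
        Literature.AlgebraicGeometry.HodgeTheory.bfSingleAdmissible n X₀ I E)) 6 3
    (fun _ _ f W ↦ ¬ HasServedFibre 6 3 (fun X θ ↦ secantQuotientAnchors X θ) (fun X θ ↦ secantQuotientServedClasses X θ) f W)

/-! ## §4 Fact-free glue by name (route-independent): (a′) ∧ (b′) ⟹ rung; rung ⟹ (b′) -/

/-- **(a′) ∧ (b′) ⟹ the registered `(6,3)` rung** `∀ C, LefAtExceptionalRegimeSixfoldMiddle (tw C AdmTw)` (skeleton stub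
`stub_rung_sixfoldMiddleTw`'s statement, byte-identical), by `lefAtExceptionalRegimeSixfoldMiddle_of_anchoredCarrierAt_of_under_not`
(transport along the pencil through a served fibre, PART Z-b §5, and excluded middle).
[cite: Markman2025SecantWeil, Thm. 1.4.1 and Thm. 1.5.1] [cite: Bloch1972Semiregularity, Remark (7.5)] [cite: vanGeemen1994HodgeAV, Thm. 4.11] -/
theorem rung_sixfoldMiddleTw_of_secantQuotientAnchorCarrier63_of_residual63
    (hA : ∀ C : ChernCharacterBetti, SecantQuotientAnchorCarrier63 C)
    (hR : ∀ C : ChernCharacterBetti, SecantQuotientResidual63 C) :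
    ∀ C : ChernCharacterBetti, LefAtExceptionalRegimeSixfoldMiddle (Literature.AlgebraicGeometry.HodgeTheory.twistedReflexiveClass C
      (fun n X₀ I E => Summit.Ventures.HSemireg.gluableSigmaAdmissible n X₀ I E ∨
        Literature.AlgebraicGeometry.HodgeTheory.bfSingleAdmissible n X₀ I E)) :=
  fun C ↦ lefAtExceptionalRegimeSixfoldMiddle_of_anchoredCarrierAt_of_under_not (hA C) (hR C)

/-- **The rung ⟹ (b′)** (a residual is a cell under an extra hypothesis): no slack the other way.
[cite: vanGeemen1994HodgeAV, §2.4] [cite: Bloch1972Semiregularity, Remark (7.5)] -/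
theorem secantQuotientResidual63_of_rung_sixfoldMiddleTw {C : ChernCharacterBetti}
    (h : LefAtExceptionalRegimeSixfoldMiddle (Literature.AlgebraicGeometry.HodgeTheory.twistedReflexiveClass C
      (fun n X₀ I E => Summit.Ventures.HSemireg.gluableSigmaAdmissible n X₀ I E ∨
        Literature.AlgebraicGeometry.HodgeTheory.bfSingleAdmissible n X₀ I E))) :
    SecantQuotientResidual63 C :=
  under_of_lefAtExceptionalRegimeAt _ (lefAtExceptionalRegimeSixfoldMiddle_iff_at.1 h)

end Summit.HodgeConjecture.HodgeConjecture.Ring2.SemiregularRepresentatives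

end
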